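import Summits.NavierStokesRegularity.NavierStokesRegularity.Theses.AxisymmetricExtremality
import Summits.NavierStokesRegularity.NavierStokesRegularity.Theorems.AxisymmetricExtremalityAxisymmetricKatoGlobalStubSeregin2020TypeIISwirlVanishes
import Summits.NavierStokesRegularity.NavierStokesRegularity.Theorems.AxisymmetricExtremalityAxisymmetricKatoGlobalStubSeregin2020TypeIIAncientLimitSwirlBounded
import Summits.NavierStokesRegularity.NavierStokesRegularity.Theorems.AxisymmetricExtremalityAxisymmetricKatoGlobalStubSeregin2020TypeIINoSwirlEndgameHolds
import HarnessLib

/-!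
# Seregin 2020, Thm 2.1 modulo Lemma 2.2: under the hypotheses of the theorem and the written-out
# weak Harnack inequality of Lemma 2.2, the blow-up index at the singular origin is `∞` (Type II)

Helper toward the stub `stub_seregin2020TypeII` of the crux `AxisymmetricKatoGlobal` (= the named
fact `Literature.Analysis.FluidPDE.Seregin2020_axisymmetricSingularPoint_typeII`, G. Seregin,
Anal. Math. Phys. 10 (2020) Paper 46 = arXiv:2006.04140, Thm 2.1). The final assembly of the
printed proof of Thm 2.1 with its one remaining unproved ingredient, Lemma 2.2 (the
Nazarov–Uraltseva-type propagation of a lower bound from the axis for supersolutions of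
`∂ₜπ + (u + 2x'/|x'|²)·∇π - Δπ ≤ 0` in the class 𝒱), kept as an explicitly WRITTEN-OUT
hypothesis (the same `∀`-statement as in `ae_swirl_eq_zero_of_weakHarnack`, where its
clause-by-clause correspondence with the printed lemma is documented):

* `blowupIndex_eq_top_of_weakHarnack` — (H) the eight hypotheses of Thm 2.1 and Lemma 2.2 ⟹
  `Seregin2020.blowupIndex 0 u G = ∞`.

Proof: if `g(0) < ∞` (Type I), the first half of the printed proof gives the ancient axisymmetric
limit `(w, π)` with (𝒜), (2.8), (2.9) and the singular origin
(`exists_ancientLimit_isAxisymmetric_swirl_bounded`); Lemma 2.2 gives `Γ ≡ 0`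
(`ae_swirl_eq_zero_of_weakHarnack`); the no-swirl endgame (`false_of_ae_swirl_eq_zero`:
swirl-free axisymmetric local energy ancient solutions are backward regular, against (2.9)) is a
contradiction. Hence, once Lemma 2.2 is proved in the tree in the rendered form, the named fact
`Seregin2020_axisymmetricSingularPoint_typeII` follows by `fun u p G h₁ … h₈ =>
blowupIndex_eq_top_of_weakHarnack u p G h₁ … h₈ lemma22`.

## References

* G. Seregin, Anal. Math. Phys. 10 (2020), Paper 46 = arXiv:2006.04140, Thm. 2.1 and its proof,
  Lemma 2.2 (arXiv pp. 4–8). [Seregin2020]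
-/

-- the problem directory repeats the summit name (D-0017); core's `dupNamespace` linter fires
set_option linter.dupNamespace false

noncomputable section

open MeasureTheory Set Function Filter Topology TopologicalSpace Metric
open scoped NNReal ENNReal Laplacian

namespace Summit.NavierStokesRegularity.NavierStokesRegularity.Theorems.AxisymmetricKatoGlobal.EulerScaling

open Literature.Analysis.FluidPDE Literature.Analysis.FluidPDE.Seregin2020

/-- **Seregin 2020, Thm 2.1, modulo Lemma 2.2 as a written-out hypothesis.** Let `(u, p)` be a
suitable weak solution of the Navier–Stokes equations in `Q = 𝒞 × ]-1, 0[` in the sense of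
Def. 1.3 (suitable on `Q`, `u ∈ L_{2,∞}(Q)`, weak spatial gradient `G ∈ L₂(Q)`, `p ∈ L_{3/2}(Q)`),
axisymmetric, with the origin a (backward) singular point — the hypotheses (H) of the named fact
`Seregin2020_axisymmetricSingularPoint_typeII` —, and ASSUME Lemma 2.2 of the paper in the
rendered form of `ae_swirl_eq_zero_of_weakHarnack` (hypothesis `hWH`, see there). Then the origin
is a Type II blow-up: `g(0) = min{limsup E, limsup A, limsup C} = ∞`
(`Seregin2020.blowupIndex 0 u G = ∞`). Proof: a finite blow-up index yields the ancient
axisymmetric limit with bounded swirl (`exists_ancientLimit_isAxisymmetric_swirl_bounded`), whose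
swirl vanishes by Lemma 2.2 (`ae_swirl_eq_zero_of_weakHarnack`), contradicting the no-swirl
endgame (`false_of_ae_swirl_eq_zero`). [cite: Seregin2020, Thm 2.1 and its proof (arXiv pp. 4–8)] -/
theorem blowupIndex_eq_top_of_weakHarnack :
    ∀ (u : ℝ → EuclideanSpace ℝ (Fin 3) → EuclideanSpace ℝ (Fin 3))
      (p : ℝ → EuclideanSpace ℝ (Fin 3) → ℝ)
      (G : ℝ → EuclideanSpace ℝ (Fin 3) → EuclideanSpace ℝ (Fin 3) →L[ℝ] EuclideanSpace ℝ (Fin 3)),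
      IsSuitableWeakSolutionOn (SereginSverak2009.parCylOpens 0 1) 1 0 u p →
      (∃ C : ℝ≥0, ∀ᵐ t ∂(volume.restrict (Ioo (-1 : ℝ) 0)),
        ∫⁻ x in SereginSverak2009.spaceCyl 0 1, ‖u t x‖ₑ ^ 2 ≤ C) →
      HasWeakSpatialGradientOn (SereginSverak2009.parCylOpens 0 1) u G →
      (∫⁻ z in SereginSverak2009.parCyl 0 1, ENNReal.ofReal (frobeniusNormSq (G z.1 z.2)) < ∞) →
      (∫⁻ z in SereginSverak2009.parCyl 0 1, ‖p z.1 z.2‖ₑ ^ (3 / 2 : ℝ) < ∞) →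
      (∀ t ∈ Ioo (-1 : ℝ) 0, IsAxisymmetric (u t)) →
      (∀ t ∈ Ioo (-1 : ℝ) 0, IsAxisymmetricScalar (p t)) →
      IsBackwardSingularPoint u 0 →
      -- Lemma 2.2 of the paper, written out (verbatim as in `ae_swirl_eq_zero_of_weakHarnack`)
      (∀ (M : ℝ) (N : ℝ≥0), ∃ β : ℝ, 0 < β ∧
        ∀ (u U : ℝ → EuclideanSpace ℝ (Fin 3) → EuclideanSpace ℝ (Fin 3))
          (p : ℝ → EuclideanSpace ℝ (Fin 3) → ℝ) (K : ℝ≥0)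
          (Φ : ℝ → EuclideanSpace ℝ (Fin 3) → ℝ) (S : Set (ℝ × EuclideanSpace ℝ (Fin 3))) (R k : ℝ),
          (∀ s, IsAxisymmetric (u s)) → (∀ s, IsAxisymmetricScalar (p s)) →
          (∀ a : ℝ, 0 < a →
            IsSuitableWeakSolutionInBall a 0 u p ∧
            cknAEss a 0 u ≤ K ∧
            cknC a 0 u ≤ K ∧
            cknD a 0 p ≤ K ∧
            ∃ G' : ℝ → EuclideanSpace ℝ (Fin 3) →
                EuclideanSpace ℝ (Fin 3) →L[ℝ] EuclideanSpace ℝ (Fin 3),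
              HasWeakSpatialGradientOn (parabolicCylinderOpens (2 * a) 0) u G' ∧
                cknAEss a 0 u + cknE a 0 G' ≤ K) →
          uncurry u =ᵐ[volume.restrict {z : ℝ × EuclideanSpace ℝ (Fin 3) | z.1 < 0}] uncurry U →
          ContinuousOn (uncurry U)
            {z : ℝ × EuclideanSpace ℝ (Fin 3) | z.1 < 0 ∧ cylRadius z.2 ≠ 0} →
          (∀ z : ℝ × EuclideanSpace ℝ (Fin 3), z.1 < 0 → cylRadius z.2 ≠ 0 →
            ContDiffAt ℝ (⊤ : ℕ∞) (U z.1) z.2) →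
          ContinuousOn (fun z : ℝ × EuclideanSpace ℝ (Fin 3) => fderiv ℝ (U z.1) z.2)
            {z : ℝ × EuclideanSpace ℝ (Fin 3) | z.1 < 0 ∧ cylRadius z.2 ≠ 0} →
          IsClosed S → (∀ z ∈ S, z.1 ≤ 0 ∧ cylRadius z.2 = 0) → IsParabolicNull 1 S →
          ContinuousOn (uncurry Φ) ({z : ℝ × EuclideanSpace ℝ (Fin 3) | z.1 < 0} \ S) →
          (∀ z : ℝ × EuclideanSpace ℝ (Fin 3), z.1 < 0 → z ∉ S →
            ContDiffAt ℝ (⊤ : ℕ∞) (Φ z.1) z.2) →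
          ContinuousOn (fun z : ℝ × EuclideanSpace ℝ (Fin 3) => fderiv ℝ (Φ z.1) z.2)
            ({z : ℝ × EuclideanSpace ℝ (Fin 3) | z.1 < 0} \ S) →
          (∀ e : EuclideanSpace ℝ (Fin 3), ContinuousOn (fun z : ℝ × EuclideanSpace ℝ (Fin 3) =>
              fderiv ℝ (fun y => fderiv ℝ (Φ z.1) y e) z.2 e)
            ({z : ℝ × EuclideanSpace ℝ (Fin 3) | z.1 < 0} \ S)) →
          (∀ z : ℝ × EuclideanSpace ℝ (Fin 3), z.1 < 0 → cylRadius z.2 ≠ 0 →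
            DifferentiableAt ℝ (fun r => Φ r z.2) z.1) →
          ContinuousOn (fun z : ℝ × EuclideanSpace ℝ (Fin 3) => deriv (fun r => Φ r z.2) z.1)
            {z : ℝ × EuclideanSpace ℝ (Fin 3) | z.1 < 0 ∧ cylRadius z.2 ≠ 0} →
          (∀ δ ρ : ℝ, 0 < δ → δ < ρ → ∃ C : ℝ, ∀ z : ℝ × EuclideanSpace ℝ (Fin 3),
            z.1 ∈ Ioo (-ρ ^ 2) 0 → δ < cylRadius z.2 → cylRadius z.2 < ρ → |z.2 2| < ρ →
              |deriv (fun r => Φ r z.2) z.1| ≤ C ∧ ‖fderiv ℝ (Φ z.1) z.2‖ ≤ C ∧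
              ∀ e : EuclideanSpace ℝ (Fin 3), ‖e‖ ≤ 1 →
                |fderiv ℝ (fun y => fderiv ℝ (Φ z.1) y e) z.2 e| ≤ C) →
          (∃ B : ℝ, ∀ z : ℝ × EuclideanSpace ℝ (Fin 3), z.1 < 0 → z ∉ S → |Φ z.1 z.2| ≤ B) →
          (∀ z : ℝ × EuclideanSpace ℝ (Fin 3), z.1 < 0 → z ∉ S → 0 ≤ Φ z.1 z.2) →
          (∀ z : ℝ × EuclideanSpace ℝ (Fin 3), z.1 < 0 → cylRadius z.2 ≠ 0 →
            deriv (fun r => Φ r z.2) z.1 + fderiv ℝ (Φ z.1) z.2 (U z.1 z.2) +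
                2 / cylRadius z.2 * partialDeriv (eR z.2) (Φ z.1) z.2 - (Laplacian.laplacian (Φ z.1)) z.2 ≤ 0) →
          0 < R → 0 < k → 1 ≤ M →
          (∫⁻ s in Ioo (-R ^ 2) 0, (∫⁻ y in ball (0 : EuclideanSpace ℝ (Fin 3)) R,
              ‖u s y‖ₑ ^ (3 : ℕ)) ^ (4 / 3 : ℝ) ≤ (N : ℝ≥0∞) * ENNReal.ofReal R ^ 2) →
          (∀ z : ℝ × EuclideanSpace ℝ (Fin 3), z.1 ∈ Ioo (-R ^ 2) 0 → cylRadius z.2 = 0 →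
            z.2 2 ∈ Ioo (-(2 * R)) (2 * R) → z ∉ S → k ≤ Φ z.1 z.2) →
          (∀ z : ℝ × EuclideanSpace ℝ (Fin 3), z.1 ∈ Ioo (-R ^ 2) 0 →
            z.2 ∈ ball (0 : EuclideanSpace ℝ (Fin 3)) (2 * R) → z ∉ S → Φ z.1 z.2 ≤ M * k) →
          ∀ᵐ z ∂(volume.restrict (parabolicCylinder (R / 2) (0 : ℝ × EuclideanSpace ℝ (Fin 3)))),
            β * k ≤ Φ z.1 z.2) →
      Seregin2020.blowupIndex 0 u G = ∞ := by
  intro u p G hsw hA hG hE hp hu_ax hp_ax hsing hWH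
  by_contra hne
  have hI : Seregin2020.blowupIndex 0 u G < ∞ := lt_top_iff_ne_top.2 hne
  obtain ⟨c, K, κ, lam, w, π, -, -, -, hsing', hax, hπax, hall⟩ :=
    exists_ancientLimit_isAxisymmetric_swirl_bounded u p G hsw hA hG hE hp hu_ax hp_ax hsing hI
  have hzero := ae_swirl_eq_zero_of_weakHarnack w π K c hax hπax
    (fun a ha => ⟨(hall a ha).1, (hall a ha).2.2.2.2.1, (hall a ha).2.2.2.2.2.1,
      (hall a ha).2.2.2.2.2.2.1, (hall a ha).2.2.2.2.2.2.2.1, (hall a ha).2.2.2.2.2.2.2.2.2⟩) hWH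
  exact false_of_ae_swirl_eq_zero u w p π K κ lam hax hsing'
    (fun a ha => ⟨(hall a ha).1, (hall a ha).2.1, (hall a ha).2.2.1, (hall a ha).2.2.2.1,
      (hall a ha).2.2.2.2.1, (hall a ha).2.2.2.2.2.1, (hall a ha).2.2.2.2.2.2.1,
      (hall a ha).2.2.2.2.2.2.2.1, (hall a ha).2.2.2.2.2.2.2.2.1⟩) hzero

end Summit.NavierStokesRegularity.NavierStokesRegularity.Theorems.AxisymmetricKatoGlobal.EulerScaling

end
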